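import Literature.NumberTheory.EllipticCurves.WeierstrassAddLawTwo
import HarnessLib

/-!
# The second addition law commutes with ring homomorphisms

For the second bidegree-`(2, 2)` addition law `add₂XYZ = (add₂X, add₂Y, add₂Z)` of
`EllipticCurves/WeierstrassAddLawTwo` (Bosma–Lenstra 1995, Theorem 2) and a ring homomorphism
`f : R → S`: `(W.map f).add₂XYZ (f ∘ P) (f ∘ Q) = f ∘ W.add₂XYZ P Q` (`map_add₂X`, `map_add₂Y`,
`map_add₂Z`, `map_add₂XYZ`), and the base-change form for algebra maps (`baseChange_add₂XYZ`) —
verbatim the pattern of Mathlib's `map_addXYZ` / `baseChange_addXYZ`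
(`Mathlib/AlgebraicGeometry/EllipticCurve/Projective/Formula.lean`). The law is a polynomial in the
coordinates and the `aᵢ` with integer coefficients, so this is `simp` with the `map_*` lemmas (Mathlib's
file-local `map_simp`).

## References

* W. Bosma, H. W. Lenstra, J. Number Theory 53 (1995), 229–240: Theorem 2. [BosmaLenstra1995]
-/

universe r s u v

open scoped WeierstrassCurve.Projective

namespace WeierstrassCurve.Projective

variable {R : Type r} {S : Type s} [CommRing R] [CommRing S] {W' : Projective R}

section Map

variable (f : R →+* S) (P Q : Fin 3 → R)

/-- `add₂X` commutes with ring homomorphisms. [cite: BosmaLenstra1995, Theorem 2] -/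
@[simp]
theorem map_add₂X : (W'.map f).add₂X (f ∘ P) (f ∘ Q) = f (W'.add₂X P Q) := by
  simp only [add₂X, map_ofNat, map_add, map_sub, map_mul, map_pow, WeierstrassCurve.map, Function.comp_apply]

/-- `add₂Y` commutes with ring homomorphisms. [cite: BosmaLenstra1995, Theorem 2] -/
@[simp]
theorem map_add₂Y : (W'.map f).add₂Y (f ∘ P) (f ∘ Q) = f (W'.add₂Y P Q) := by
  simp only [add₂Y, map_ofNat, map_add, map_sub, map_mul, map_pow, WeierstrassCurve.map, Function.comp_apply]

/-- `add₂Z` commutes with ring homomorphisms. [cite: BosmaLenstra1995, Theorem 2] -/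
@[simp]
theorem map_add₂Z : (W'.map f).add₂Z (f ∘ P) (f ∘ Q) = f (W'.add₂Z P Q) := by
  simp only [add₂Z, map_ofNat, map_add, map_mul, map_pow, WeierstrassCurve.map, Function.comp_apply]

/-- **The second addition law commutes with ring homomorphisms.** [cite: BosmaLenstra1995, Theorem 2] -/
@[simp]
theorem map_add₂XYZ : (W'.map f).add₂XYZ (f ∘ P) (f ∘ Q) = f ∘ W'.add₂XYZ P Q := by
  simp only [add₂XYZ, map_add₂X, map_add₂Y, map_add₂Z, comp_fin3]

end Map

section BaseChange

variable {A : Type u} {B : Type v} [CommRing A] [CommRing B] [Algebra R S] [Algebra R A] [Algebra S A]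
  [IsScalarTower R S A] [Algebra R B] [Algebra S B] [IsScalarTower R S B] (f : A →ₐ[S] B)
  (P Q : Fin 3 → A)

/-- **Base-change form**: for an algebra map `f : A → B`, `(W⁄B).add₂XYZ (f ∘ P) (f ∘ Q) = f ∘ (W⁄A).add₂XYZ P Q`.
[cite: BosmaLenstra1995, Theorem 2] -/
theorem baseChange_add₂XYZ : (W'⁄B).add₂XYZ (f ∘ P) (f ∘ Q) = f ∘ (W'⁄A).add₂XYZ P Q := by
  rw [← RingHom.coe_coe, ← map_add₂XYZ, map_baseChange]

end BaseChange

end WeierstrassCurve.Projective
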